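import Literature.NumberTheory.Automorphic.UnitaryGroupTransferAwayPartner
import HarnessLib

/-!
# Finite sums of matched pure tensors: the LINEAR SPAN of the away-transfer relation `GlobalTransferAway`
(Rogawski (1990), §14.2 p. 233; §14.5 p. 237 «we assume from now on that `f = Π f_v` …»)

Topic `NumberTheory/Automorphic`; namespace `Literature.NumberTheory.Automorphic.UnitaryGroup`.  ONE definition with body
(`GlobalTransferAwaySpan`, a RELATION — nothing is asserted) and proved theorems; no named fact, no `sorry`, no instance, no notation.

★ `GlobalTransferAway ψ S₀ f′ f` (`UnitaryGroupTransferAway`, B11) relates ONE pure tensor on `U(H)` to ONE on `U(H′)` whose local factors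
match along `ψ_v` away from `S₀ ∪ S ∪ S′`.  The trace formula is LINEAR in the test function, and Rogawski's comparison is first stated for
pure tensors and then extended by linearity ([Rogawski1990] §14.5: «we assume from now on that `f = Π f_v`»).  This file provides the linear
span of the relation — the form a later LINEARITY law of the ENGINE T1 kit quantifies over:

* §1 `GlobalTransferAwaySpan ψ S₀ f′ f` := `f′ = Σ aᵢ Tᵢ`, `f = Σ aᵢ T′ᵢ` (the SAME coefficients) with `Tᵢ ↔ T′ᵢ` matched away from
  `S₀ ∪ Sᵢ ∪ S′ᵢ` for every `i`; `GlobalTransferAway.span` (a matched pair is a span of length one).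
* §2 linearity: `GlobalTransferAwaySpan.zero`, `.add` (concatenation of the families, `Fin.sum_univ_add`), `.smul`, `.neg`, `.sub`.
* §3 non-vacuity (`exists_globalTransferAwaySpan_ne_zero`, from ★ B11 (N)) and SMOOTH-SPAN partners (`exists_smoothSpan_globalTransferAwaySpan_of_smoothSpan`:
  every `f′ = Σ aᵢ Tᵢ.eval` with `Tᵢ.IsTest` has `f = Σ aᵢ T′ᵢ.eval`, `T′ᵢ.IsTest`, with `GlobalTransferAwaySpan ψ S₀ f′ f` — ★ B11c pointwise).

Written for the cell `hodgecm-mathlib` (ENGINE T1, line `F0_T1InnerFormTraceIdentity`, brick B11d).  HC_CM is proved only modulo the printed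
citations until rung 0 closes; this file is unconditional.

## References
* [Rogawski1990] J. Rogawski, Ann. of Math. Stud. 123 (1990), §14.2 p. 233, §14.5 p. 237.
-/

set_option autoImplicit false

noncomputable section

open NumberField IsDedekindDomain Filter Set
open scoped Classical

namespace Literature.NumberTheory.Automorphic.UnitaryGroup

variable (L : Type) [Field L] [NumberField L] [IsCMField L] (N : ℕ) {H H' : Matrix (Fin N) (Fin N) L}

/-! ## §1 The span relation -/

/-- **`GlobalTransferAwaySpan ψ S₀ f′ f`** — `f′` and `f` are FINITE LINEAR COMBINATIONS, with the same coefficients, of pure tensors matched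
pairwise away from the bad places: `∃ n (T T′ : Fin n → PureTensor) (a : Fin n → ℂ)`, `⇑f′ = Σ aᵢ • (T i).eval`, `⇑f = Σ aᵢ • (T′ i).eval`,
`∀ i, LocalTransferAway ψ (T i) (T′ i) (S₀ ∪ (T i).S ∪ (T′ i).S)`.  A RELATION (the linear span of ★ `GlobalTransferAway`); nothing is
asserted at the bad places or at infinity. [cite: Rogawski1990, §14.2 p. 233] -/
def GlobalTransferAwaySpan
    (ψ : ∀ v : HeightOneSpectrum (𝓞 ↥(maximalRealSubfield L)), (cmDatum L N H).Local v ≃ₜ* (cmDatum L N H').Local v)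
    (S₀ : Finset (HeightOneSpectrum (𝓞 ↥(maximalRealSubfield L))))
    (f' : CompactlySupportedContinuousMap (cmDatum L N H).Adelic ℂ)
    (f : CompactlySupportedContinuousMap (cmDatum L N H').Adelic ℂ) : Prop :=
  ∃ (n : ℕ) (T : Fin n → PureTensor L N H) (T' : Fin n → PureTensor L N H') (a : Fin n → ℂ),
    (⇑f' = ∑ i, a i • (T i).eval) ∧ (⇑f = ∑ i, a i • (T' i).eval) ∧
      ∀ i, LocalTransferAway L N ψ (T i) (T' i) (S₀ ∪ (T i).S ∪ (T' i).S)

variable {L N}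
variable {ψ : ∀ v : HeightOneSpectrum (𝓞 ↥(maximalRealSubfield L)), (cmDatum L N H).Local v ≃ₜ* (cmDatum L N H').Local v}
  {S₀ : Finset (HeightOneSpectrum (𝓞 ↥(maximalRealSubfield L)))}

/-- A matched pair of pure tensors is a span of length one. [cite: Rogawski1990, §14.2 p. 233] -/
theorem GlobalTransferAway.span {f' : CompactlySupportedContinuousMap (cmDatum L N H).Adelic ℂ}
    {f : CompactlySupportedContinuousMap (cmDatum L N H').Adelic ℂ} (h : GlobalTransferAway L N ψ S₀ f' f) :
    GlobalTransferAwaySpan L N ψ S₀ f' f := by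
  obtain ⟨T, T', hf', hf, hloc⟩ := h
  refine ⟨1, fun _ => T, fun _ => T', fun _ => 1, ?_, ?_, fun _ => hloc⟩
  · rw [Fin.sum_univ_one, one_smul, hf']
  · rw [Fin.sum_univ_one, one_smul, hf]

/-! ## §2 Linearity -/

namespace GlobalTransferAwaySpan

/-- The empty span: `0 ↔ 0`. [cite: Rogawski1990, §14.2 p. 233] -/
theorem zero : GlobalTransferAwaySpan L N ψ S₀ 0 0 :=
  ⟨0, Fin.elim0, Fin.elim0, Fin.elim0, by rw [Fin.sum_univ_zero, CompactlySupportedContinuousMap.coe_zero],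
    by rw [Fin.sum_univ_zero, CompactlySupportedContinuousMap.coe_zero], fun i => i.elim0⟩

/-- Spans ADD (concatenate the two families). [cite: Rogawski1990, §14.2 p. 233] -/
theorem add {f'₁ f'₂ : CompactlySupportedContinuousMap (cmDatum L N H).Adelic ℂ}
    {f₁ f₂ : CompactlySupportedContinuousMap (cmDatum L N H').Adelic ℂ}
    (h₁ : GlobalTransferAwaySpan L N ψ S₀ f'₁ f₁) (h₂ : GlobalTransferAwaySpan L N ψ S₀ f'₂ f₂) :
    GlobalTransferAwaySpan L N ψ S₀ (f'₁ + f'₂) (f₁ + f₂) := by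
  obtain ⟨n, T₁, T'₁, a₁, hf'₁, hf₁, hl₁⟩ := h₁
  obtain ⟨m, T₂, T'₂, a₂, hf'₂, hf₂, hl₂⟩ := h₂
  refine ⟨n + m, Fin.append T₁ T₂, Fin.append T'₁ T'₂, Fin.append a₁ a₂, ?_, ?_, fun i => ?_⟩
  · rw [CompactlySupportedContinuousMap.coe_add, hf'₁, hf'₂, Fin.sum_univ_add]
    simp only [Fin.append_left, Fin.append_right]
  · rw [CompactlySupportedContinuousMap.coe_add, hf₁, hf₂, Fin.sum_univ_add]
    simp only [Fin.append_left, Fin.append_right]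
  · refine Fin.addCases (fun i => ?_) (fun i => ?_) i
    · simp only [Fin.append_left]
      exact hl₁ i
    · simp only [Fin.append_right]
      exact hl₂ i

/-- Spans are stable under SCALARS. [cite: Rogawski1990, §14.2 p. 233] -/
theorem smul {f' : CompactlySupportedContinuousMap (cmDatum L N H).Adelic ℂ}
    {f : CompactlySupportedContinuousMap (cmDatum L N H').Adelic ℂ} (h : GlobalTransferAwaySpan L N ψ S₀ f' f) (c : ℂ) :
    GlobalTransferAwaySpan L N ψ S₀ (c • f') (c • f) := by
  obtain ⟨n, T, T', a, hf', hf, hl⟩ := h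
  refine ⟨n, T, T', fun i => c * a i, ?_, ?_, hl⟩
  · rw [CompactlySupportedContinuousMap.coe_smul, hf', Finset.smul_sum]
    simp only [smul_smul]
  · rw [CompactlySupportedContinuousMap.coe_smul, hf, Finset.smul_sum]
    simp only [smul_smul]

/-- Spans are stable under NEGATION. [cite: Rogawski1990, §14.2 p. 233] -/
theorem neg {f' : CompactlySupportedContinuousMap (cmDatum L N H).Adelic ℂ}
    {f : CompactlySupportedContinuousMap (cmDatum L N H').Adelic ℂ} (h : GlobalTransferAwaySpan L N ψ S₀ f' f) :
    GlobalTransferAwaySpan L N ψ S₀ (-f') (-f) := by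
  obtain ⟨n, T, T', a, hf', hf, hl⟩ := h
  refine ⟨n, T, T', fun i => -a i, ?_, ?_, hl⟩
  · rw [CompactlySupportedContinuousMap.coe_neg, hf', ← Finset.sum_neg_distrib]
    simp only [neg_smul]
  · rw [CompactlySupportedContinuousMap.coe_neg, hf, ← Finset.sum_neg_distrib]
    simp only [neg_smul]

/-- Spans SUBTRACT. [cite: Rogawski1990, §14.2 p. 233] -/
theorem sub {f'₁ f'₂ : CompactlySupportedContinuousMap (cmDatum L N H).Adelic ℂ}
    {f₁ f₂ : CompactlySupportedContinuousMap (cmDatum L N H').Adelic ℂ}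
    (h₁ : GlobalTransferAwaySpan L N ψ S₀ f'₁ f₁) (h₂ : GlobalTransferAwaySpan L N ψ S₀ f'₂ f₂) :
    GlobalTransferAwaySpan L N ψ S₀ (f'₁ - f'₂) (f₁ - f₂) := by
  rw [sub_eq_add_neg, sub_eq_add_neg]
  exact h₁.add h₂.neg

/-- Finite sums of spans are spans. [cite: Rogawski1990, §14.2 p. 233] -/
theorem sum {ι : Type*} (s : Finset ι) {f' : ι → CompactlySupportedContinuousMap (cmDatum L N H).Adelic ℂ}
    {f : ι → CompactlySupportedContinuousMap (cmDatum L N H').Adelic ℂ} (h : ∀ i ∈ s, GlobalTransferAwaySpan L N ψ S₀ (f' i) (f i)) :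
    GlobalTransferAwaySpan L N ψ S₀ (∑ i ∈ s, f' i) (∑ i ∈ s, f i) := by
  induction s using Finset.induction_on with
  | empty => simpa only [Finset.sum_empty] using (zero : GlobalTransferAwaySpan L N ψ S₀ 0 0)
  | insert j s hj ih =>
    rw [Finset.sum_insert hj, Finset.sum_insert hj]
    exact (h j (Finset.mem_insert_self j s)).add (ih fun i hi => h i (Finset.mem_insert_of_mem hi))

end GlobalTransferAwaySpan

/-! ## §3 Non-vacuity and smooth-span partners -/

variable (L N)

/-- **Non-vacuity**: if the `ψ_v` match the integral levels off `S₀`, some `f′ ≠ 0` is in span-relation with some `f` (★ B11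
`exists_globalTransferAway_ne_zero`, a span of length one). [cite: Rogawski1990, §14.2 p. 233] -/
theorem exists_globalTransferAwaySpan_ne_zero
    (ψ : ∀ v : HeightOneSpectrum (𝓞 ↥(maximalRealSubfield L)), (cmDatum L N H).Local v ≃ₜ* (cmDatum L N H').Local v)
    (S₀ : Finset (HeightOneSpectrum (𝓞 ↥(maximalRealSubfield L))))
    (hψ : ∀ v ∉ S₀, ∀ g, ψ v g ∈ cmLocalIntegralLevel L N H' v ↔ g ∈ cmLocalIntegralLevel L N H v) :
    ∃ (f' : CompactlySupportedContinuousMap (cmDatum L N H).Adelic ℂ)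
      (f : CompactlySupportedContinuousMap (cmDatum L N H').Adelic ℂ), f' ≠ 0 ∧ GlobalTransferAwaySpan L N ψ S₀ f' f := by
  obtain ⟨f', f, hf', h⟩ := exists_globalTransferAway_ne_zero L N ψ S₀ hψ
  exact ⟨f', f, hf', h.span⟩

/-- **SMOOTH-SPAN partners**: every finite linear combination `f′ = Σ aᵢ • Tᵢ.eval` of `IsTest` pure tensors on `U(H)` has a finite linear
combination `f = Σ aᵢ • T′ᵢ.eval` of `IsTest` pure tensors on `U(H′)` with `GlobalTransferAwaySpan ψ S₀ f′ f` (★ B11c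
`PureTensor.exists_isTest_forall_loc_eq_comp_symm`, index by index) — the satisfiability of a LINEAR `Transfer` pinned to the span relation.
[cite: Rogawski1990, §14.5 p. 237] -/
theorem exists_smoothSpan_globalTransferAwaySpan_of_smoothSpan
    (ψ : ∀ v : HeightOneSpectrum (𝓞 ↥(maximalRealSubfield L)), (cmDatum L N H).Local v ≃ₜ* (cmDatum L N H').Local v)
    (S₀ : Finset (HeightOneSpectrum (𝓞 ↥(maximalRealSubfield L))))
    (hψ : ∀ v ∉ S₀, ∀ g, ψ v g ∈ cmLocalIntegralLevel L N H' v ↔ g ∈ cmLocalIntegralLevel L N H v)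
    (f' : CompactlySupportedContinuousMap (cmDatum L N H).Adelic ℂ)
    (hf' : ∃ (n : ℕ) (T : Fin n → PureTensor L N H) (a : Fin n → ℂ), (∀ i, (T i).IsTest) ∧ ⇑f' = ∑ i, a i • (T i).eval) :
    ∃ f : CompactlySupportedContinuousMap (cmDatum L N H').Adelic ℂ,
      (∃ (n : ℕ) (T' : Fin n → PureTensor L N H') (a : Fin n → ℂ), (∀ i, (T' i).IsTest) ∧ ⇑f = ∑ i, a i • (T' i).eval) ∧
        GlobalTransferAwaySpan L N ψ S₀ f' f := by
  obtain ⟨n, T, a, hT, hf'⟩ := hf'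
  -- choose a partner for each index
  have hex : ∀ i, ∃ T' : PureTensor L N H', T'.IsTest ∧ T'.S = S₀ ∪ (T i).S ∧ ∀ v, T'.loc v = (T i).loc v ∘ (ψ v).symm :=
    fun i => PureTensor.exists_isTest_forall_loc_eq_comp_symm L N ψ S₀ hψ (T i) (hT i).isUnramified (hT i).isFinSmooth
  choose T' hT' hS hloc using hex
  -- the `C_c` partner
  let g : Fin n → CompactlySupportedContinuousMap (cmDatum L N H').Adelic ℂ := fun i =>
    (T' i).toCc (hT' i).isUnramified (hT' i).isArchTest.continuous_arch (hT' i).isArchTest.hasCompactSupport_arch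
      (fun v _ => PureTensor.continuous_loc (hT' i).isUnramified (hT' i).isFinSmooth v)
      (fun v _ => PureTensor.hasCompactSupport_loc (hT' i).isUnramified (hT' i).isFinSmooth v)
  have hg : ∀ i, ⇑(g i) = (T' i).eval := fun _ => rfl
  have hsum : ⇑(∑ i, a i • g i) = ∑ i, a i • (T' i).eval := by
    rw [CompactlySupportedContinuousMap.coe_sum]
    refine Finset.sum_congr rfl fun i _ => ?_
    rw [CompactlySupportedContinuousMap.coe_smul, hg]
  exact ⟨∑ i, a i • g i, ⟨n, T', a, hT', hsum⟩, n, T, T', a, hf', hsum, fun i v _ => hloc i v⟩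

end Literature.NumberTheory.Automorphic.UnitaryGroup

end
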